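import Literature.Analysis.PDE.FrameOperator
import HarnessLib

/-!
# The heat residual of a cut-off chart expression: the localisation identity of the a priori
# estimates (topic `Analysis/PDE`)

Analytic layer of the programme to prove short-time existence for quasilinear strictly
parabolic systems on a closed manifold (hypothesis `hQL` of
`Literature.Geometry.Riemannian.ricciFlow_shortTime_existence_of_quasilinear`). In a patch of
the model `E` (standard frame `(bₖ)`), a chart expression `u` of a solution satisfies
`∂ₜu = principalPart (S y) u + 𝔟 (Du) + 𝔠 u + g` on the chart image `V`; the a priori
estimates are run for the cut-off `w = cut • u` (`tsupport cut ⊆ V`), whose flat heat residual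
`cut • ∂ₜu - Δw` this file expands (`cut_smul_sub_laplacian_smul_eq`), pointwise and
EVERYWHERE, as

  `principalPart (S y - 1) w y`  (top order, same patch, coefficient `S - 1` small)
  `- lowerSymbol S cut u y`       (first/zeroth order in `u`, from commuting `cut` through the
                                   principal part: `Σₖₗ mₖₗ((∂ₖcut)∂ₗu + (∂ₗcut)∂ₖu) + (Σₖₗ mₖₗ∂ₖ∂ₗcut) u`)
  `+ cut • (𝔟 (Du) + 𝔠 u + g)`   (lower order and source)
  `- 2 Σₗ (∂ₗcut) • ∂ₗu - (Δcut) • u`   (commutator of `Δ` with `cut`),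

all lower-order terms being products of derivatives of `cut` (supported in `tsupport cut`)
with `u`, `Du` — the terms that the programme re-localises into the other patches. The
identity is pure algebra on top of the cut-off calculus (`CutoffCalculus.lean`) and the frame
form of second-order operators (`FrameOperator.lean`).

Everything is proved; no named fact and no `sorry` is introduced.

## References

* L. C. Evans, *Partial Differential Equations*, 2nd ed., AMS 2010, §6.3.1 (the cut-off
  computation of interior regularity) and §7.1.3. [Evans2010]
-/

noncomputable section

open Set Function Filter Topology InnerProductSpace
open scoped RealInnerProductSpace Laplacian ContDiff

namespace Literature.Analysis.PDE

variable {E : Type*} [NormedAddCommGroup E] [InnerProductSpace ℝ E] [FiniteDimensional ℝ E]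
variable {F : Type*} [NormedAddCommGroup F] [NormedSpace ℝ F]

/-- **The lower-order terms produced by commuting a cut-off through a principal part**:
`lowerSymbol S cut u y = Σₖₗ mₖₗ ((∂ₖcut)∂ₗu + (∂ₗcut)∂ₖu)(y) + (Σₖₗ mₖₗ ∂ₖ∂ₗcut(y)) u(y)`,
`mₖₗ = ⟪bₖ, S bₗ⟫`. [cite: Evans2010, §6.3.1] -/
def lowerSymbol (S : E →L[ℝ] E) (cut : E → ℝ) (u : E → F) (y : E) : F :=
  (∑ k, ∑ l, ⟪stdOrthonormalBasis ℝ E k, S (stdOrthonormalBasis ℝ E l)⟫ •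
      (fderiv ℝ cut y (stdOrthonormalBasis ℝ E k) • fderiv ℝ u y (stdOrthonormalBasis ℝ E l) +
        fderiv ℝ cut y (stdOrthonormalBasis ℝ E l) • fderiv ℝ u y (stdOrthonormalBasis ℝ E k))) +
    (∑ k, ∑ l, ⟪stdOrthonormalBasis ℝ E k, S (stdOrthonormalBasis ℝ E l)⟫ *
      fderiv ℝ (fun z ↦ fderiv ℝ cut z (stdOrthonormalBasis ℝ E l)) y (stdOrthonormalBasis ℝ E k)) • u y

/-- `lowerSymbol_apply`: unfolding. [folklore] -/
theorem lowerSymbol_apply (S : E →L[ℝ] E) (cut : E → ℝ) (u : E → F) (y : E) :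
    lowerSymbol S cut u y =
      (∑ k, ∑ l, ⟪stdOrthonormalBasis ℝ E k, S (stdOrthonormalBasis ℝ E l)⟫ •
        (fderiv ℝ cut y (stdOrthonormalBasis ℝ E k) • fderiv ℝ u y (stdOrthonormalBasis ℝ E l) +
          fderiv ℝ cut y (stdOrthonormalBasis ℝ E l) • fderiv ℝ u y (stdOrthonormalBasis ℝ E k))) +
      (∑ k, ∑ l, ⟪stdOrthonormalBasis ℝ E k, S (stdOrthonormalBasis ℝ E l)⟫ *
        fderiv ℝ (fun z ↦ fderiv ℝ cut z (stdOrthonormalBasis ℝ E l)) y (stdOrthonormalBasis ℝ E k)) • u y :=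
  rfl

/-- Off the support of the cut-off the lower symbol terms vanish. [folklore] -/
theorem lowerSymbol_eq_zero (S : E →L[ℝ] E) {cut : E → ℝ} (u : E → F) {y : E} (hy : y ∉ tsupport cut) :
    lowerSymbol S cut u y = 0 := by
  have h1 : fderiv ℝ cut y = 0 := fderiv_of_notMem_tsupport ℝ hy
  have h2 : ∀ l, fderiv ℝ (fun z ↦ fderiv ℝ cut z (stdOrthonormalBasis ℝ E l)) y = 0 := fun l ↦
    fderiv_of_notMem_tsupport ℝ fun h ↦ hy (tsupport_fderiv_apply_subset ℝ _ h)
  simp [lowerSymbol_apply, h1, h2]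

/-- **Commuting the cut-off through the principal part** (pointwise, everywhere):
`cut(y) • principalPart S u y = principalPart S (cut • u) y - lowerSymbol S cut u y` for `u` smooth on
an open `V ⊇ tsupport cut`. [cite: Evans2010, §6.3.1] -/
theorem cut_smul_principalPart_eq {V : Set E} (hV : IsOpen V) {cut : E → ℝ} (hcut : ContDiff ℝ ∞ cut)
    (hcutV : tsupport cut ⊆ V) {u : E → F} (hu : ContDiffOn ℝ ∞ u V) (S : E →L[ℝ] E) (y : E) :
    cut y • principalPart S u y = principalPart S (fun z ↦ cut z • u z) y - lowerSymbol S cut u y := by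
  rw [principalPart_apply, principalPart_apply, lowerSymbol_apply,
    sum_sum_smul_fderiv_fderiv_smul (fun i ↦ stdOrthonormalBasis ℝ E i)
      (fun k l ↦ ⟪stdOrthonormalBasis ℝ E k, S (stdOrthonormalBasis ℝ E l)⟫) hV hcut hcutV hu y]
  abel

/-- The frame Laplacian `Σₗ ∂ₗ∂ₗu` is the principal part with symbol `1` (no smoothness needed).
[folklore] -/
theorem sum_fderiv_fderiv_eq_principalPart_one (u : E → F) (y : E) :
    ∑ l, fderiv ℝ (fun z ↦ fderiv ℝ u z (stdOrthonormalBasis ℝ E l)) y (stdOrthonormalBasis ℝ E l) =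
      principalPart (1 : E →L[ℝ] E) u y := by
  rw [principalPart_eq_sum_fderiv_fderiv]
  rfl

/-- **The heat residual of a cut-off chart expression.** Let `u` be smooth on an open
`V ⊇ tsupport cut` and satisfy at `y` the chart form of a parabolic system,
`uₜ(y) = principalPart (S y) u y + 𝔟 (Du(y)) + 𝔠 (u y) + g(y)` (the value `uₜ y` of the time
derivative is a datum here). Then for `w = cut • u` and every `y`:
`cut y • uₜ y - Δw y = principalPart (S y - 1) w y - lowerSymbol (S y - 1) cut u y
  + cut y • (𝔟 (Du y) + 𝔠 (u y) + g y) - 2 Σₗ (∂ₗcut y) • ∂ₗu y - (Δcut y) • u y`.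
[cite: Evans2010, §7.1.3] -/
theorem cut_smul_sub_laplacian_smul_eq {V : Set E} (hV : IsOpen V) {cut : E → ℝ}
    (hcut : ContDiff ℝ ∞ cut) (hcutV : tsupport cut ⊆ V) {u : E → F} (hu : ContDiffOn ℝ ∞ u V)
    (S : E → (E →L[ℝ] E)) (𝔟 : (E →L[ℝ] F) →L[ℝ] F) (𝔠 : F →L[ℝ] F) (g : E → F) {uₜ : E → F} {y : E}
    (hpde : uₜ y = principalPart (S y) u y + 𝔟 (fderiv ℝ u y) + 𝔠 (u y) + g y) :
    cut y • uₜ y - (Δ (fun z ↦ cut z • u z)) y =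
      principalPart (S y - 1) (fun z ↦ cut z • u z) y - lowerSymbol (S y - 1) cut u y +
        cut y • (𝔟 (fderiv ℝ u y) + 𝔠 (u y) + g y) -
        (2 • ∑ l, fderiv ℝ cut y (stdOrthonormalBasis ℝ E l) • fderiv ℝ u y (stdOrthonormalBasis ℝ E l)) -
        (Δ cut) y • u y := by
  rw [hpde, laplacian_smul_of_tsupport_subset hV hcut hcutV hu y,
    sum_fderiv_fderiv_eq_principalPart_one u y,
    ← cut_smul_principalPart_eq hV hcut hcutV hu (S y - 1) y, principalPart_sub]
  simp only [smul_sub, smul_add]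
  abel

/-- The same identity with the residual written as a function (`fun y ↦ …`), for use under
energies. [cite: Evans2010, §7.1.3] -/
theorem cut_smul_sub_laplacian_smul_funext {V : Set E} (hV : IsOpen V) {cut : E → ℝ}
    (hcut : ContDiff ℝ ∞ cut) (hcutV : tsupport cut ⊆ V) {u : E → F} (hu : ContDiffOn ℝ ∞ u V)
    (S : E → (E →L[ℝ] E)) (𝔟 : (E →L[ℝ] F) →L[ℝ] F) (𝔠 : F →L[ℝ] F) (g : E → F) {uₜ : E → F}
    (hpde : ∀ y ∈ V, uₜ y = principalPart (S y) u y + 𝔟 (fderiv ℝ u y) + 𝔠 (u y) + g y)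
    (hoff : ∀ y ∉ V, uₜ y = principalPart (S y) u y + 𝔟 (fderiv ℝ u y) + 𝔠 (u y) + g y ∨ cut y = 0) :
    (fun y ↦ cut y • uₜ y - (Δ (fun z ↦ cut z • u z)) y) =
      fun y ↦ principalPart (S y - 1) (fun z ↦ cut z • u z) y - lowerSymbol (S y - 1) cut u y +
        cut y • (𝔟 (fderiv ℝ u y) + 𝔠 (u y) + g y) -
        (2 • ∑ l, fderiv ℝ cut y (stdOrthonormalBasis ℝ E l) • fderiv ℝ u y (stdOrthonormalBasis ℝ E l)) -
        (Δ cut) y • u y := by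
  funext y
  by_cases hy : y ∈ V
  · exact cut_smul_sub_laplacian_smul_eq hV hcut hcutV hu S 𝔟 𝔠 g (hpde y hy)
  · rcases hoff y hy with h | h
    · exact cut_smul_sub_laplacian_smul_eq hV hcut hcutV hu S 𝔟 𝔠 g h
    · -- off `V` everything vanishes: `cut = 0` near `y`
      have hy' : y ∉ tsupport cut := fun h' ↦ hy (hcutV h')
      obtain ⟨h0, h1⟩ := eq_zero_of_notMem_tsupport cut hy'
      have hw : (fun z ↦ cut z • u z) =ᶠ[𝓝 y] fun _ ↦ 0 := by
        rw [notMem_tsupport_iff_eventuallyEq] at hy'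
        filter_upwards [hy'] with z hz
        simp [hz]
      have hΔw : (Δ (fun z ↦ cut z • u z)) y = 0 := by
        rw [laplacian_smul_of_tsupport_subset hV hcut hcutV hu y, h0, h1]
        have hΔc : (Δ cut) y = 0 := by
          have hev : cut =ᶠ[𝓝 y] fun _ ↦ 0 := by rwa [notMem_tsupport_iff_eventuallyEq] at hy'
          rw [laplacian_eq_iteratedFDeriv_stdOrthonormalBasis]
          simp [(hev.iteratedFDeriv ℝ 2).self_of_nhds, iteratedFDeriv_const_of_ne two_ne_zero]
        simp [hΔc]
      have hP : principalPart (S y - 1) (fun z ↦ cut z • u z) y = 0 := by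
        rw [principalPart_apply]
        refine Finset.sum_eq_zero fun k _ ↦ Finset.sum_eq_zero fun l _ ↦ ?_
        have hd : fderiv ℝ (fun z ↦ fderiv ℝ (fun z ↦ cut z • u z) z (stdOrthonormalBasis ℝ E l)) y = 0 := by
          refine fderiv_of_notMem_tsupport ℝ fun h' ↦ hy' ?_
          exact tsupport_smul_subset_left cut u (tsupport_fderiv_apply_subset ℝ _ h')
        rw [hd]
        simp
      have hΔc : (Δ cut) y = 0 := by
        have hev : cut =ᶠ[𝓝 y] fun _ ↦ 0 := by rwa [notMem_tsupport_iff_eventuallyEq] at hy'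
        rw [laplacian_eq_iteratedFDeriv_stdOrthonormalBasis]
        simp [(hev.iteratedFDeriv ℝ 2).self_of_nhds, iteratedFDeriv_const_of_ne two_ne_zero]
      rw [hΔw, hP, lowerSymbol_eq_zero _ u hy', h, h1, hΔc]
      simp

end Literature.Analysis.PDE

end
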